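import Literature.Barriers.FinalStateConjecture.KleinGordonRadialCurrent
import HarnessLib

/-!
# Barrier catalogue `FinalStateConjecture`: Shlapentokh-Rothman's unstable Klein–Gordon modes —
# conservation of the energy current `Q_T = Im(Δ R' R̄)` and of the Wronskian of the radial ODE
(`Literature/Barriers/FinalStateConjecture/`, D-0021, D-0014; family `gr`; namespace
`Literature.Barriers.FinalStateConjecture`)

Shlapentokh-Rothman, Comm. Math. Phys. 329 (2014), §3.1: for the energy current
`Q_T := Im(Δ dR/dr · R̄)` of a solution of the radial ODE (2.2) with REAL parameters
(`ω ∈ ℝ`, `λ ∈ ℝ`, so that `V_μ` is real) "the radial ODE implies that `dQ_T/dr = 0`"; and (§4.3,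
App. C.3) the connection coefficients of a solution with respect to a basis are quotients of
Wronskians, constant in `r`. In the vocabulary of `KleinGordonModeConstruction.lean`:

* `hasDerivAt_im_radialFlux` — for any parameters, `d/dr Im(Δ R' R̄) = Im(V_μ) |R|²/Δ` on
  `(r₊, ∞)`;
* `kgRadialPotential_im_eq_zero` — `V_μ` is real when `ω` and `λ` are;
* `im_radialFlux_eq` — **`dQ_T/dr = 0`**: for real `ω`, `λ`, `Im(Δ R' R̄)` is constant on `(r₊, ∞)`;
* `hasDerivAt_radialWronskian`, `radialWronskian_eq` — for two solutions `R₁`, `R₂` of the same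
  radial ODE, the weighted Wronskian `Δ (R₁' R₂ − R₂' R₁)` is constant on `(r₊, ∞)` (Abel's identity
  for `Δ (Δ R')' = V_μ R`);
* `im_flux_combination`, `im_radialFlux_combination` — for `φ = Aρ₁ + Bρ₂` with `ρ₁`, `ρ₂`
  real-valued solutions, `Q_T = Im(A B̄) · Δ(ρ₁'ρ₂ − ρ₂'ρ₁)` (SR §4.3: the current in terms of the
  connection coefficients, the identity behind `am − 2Mr₊ω_R = 2√(μ²−ω_R²) Im(A B̄)`).

Everything is proved; no named facts.

## References

* Y. Shlapentokh-Rothman, Comm. Math. Phys. 329 (2014) 859–891, arXiv:1302.3448: §3.1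
  (`dQ_T/dr = 0`), §4.3 (4.x: `R = Aρ₁ + Bρ₂`), App. C.3 (`A = W(R, ρ₂)/W(ρ₁, ρ₂)`) (held copy
  `paper:arxiv-1302.3448`, pp. 8, 11, 19). Key `ShlapentokhRothman2014KleinGordon`.
-/

noncomputable section

open Set Filter
open scoped Topology Real ContDiff ComplexConjugate

namespace Literature.Barriers.FinalStateConjecture

open Literature.Geometry.Lorentzian

variable {M a : ℝ} {w Λ : ℂ} {m : ℤ} {μ : ℝ} {R R₁ R₂ : ℝ → ℂ}

/-! ### The energy current `Q_T = Im(Δ R' R̄)` -/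

/-- **`d/dr Im(Δ R' R̄) = Im(V_μ) |R|²/Δ`** on `(r₊, ∞)` for a solution of the radial ODE (2.2)
(`(Δ R' R̄)' = (V_μ/Δ)|R|² + Δ|R'|²`, the second term being real).
[cite: ShlapentokhRothman2014KleinGordon, §3.1] -/
theorem hasDerivAt_im_radialFlux (hMa : Kerr.IsSubextremal M a) (hR : IsRadialSolution M a w m Λ μ R)
    {r : ℝ} (hr : Kerr.rPlus M a < r) :
    HasDerivAt (fun s : ℝ ↦ (((Kerr.delta M a s : ℝ) : ℂ) * deriv R s * conj (R s)).im)
      ((kgRadialPotential M a w m Λ μ r).im * ‖R r‖ ^ 2 / Kerr.delta M a r) r := by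
  have hΔpos : 0 < Kerr.delta M a r := Kerr.delta_pos hMa.le hr
  have hΔ : ((Kerr.delta M a r : ℝ) : ℂ) ≠ 0 := Complex.ofReal_ne_zero.2 hΔpos.ne'
  have hflux := hasDerivAt_radialFlux hMa hR hr
  have hRc : HasDerivAt (fun s ↦ conj (R s)) (conj (deriv R r)) r := by
    have h := (hR.hasDerivAt hr).1.star
    simpa using h
  have hK : HasDerivAt (fun s : ℝ ↦ ((Kerr.delta M a s : ℝ) : ℂ) * deriv R s * conj (R s))
      (kgRadialPotential M a w m Λ μ r * R r / ((Kerr.delta M a r : ℝ) : ℂ) * conj (R r) +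
        ((Kerr.delta M a r : ℝ) : ℂ) * deriv R r * conj (deriv R r)) r :=
    hflux.fun_mul hRc
  have him : HasDerivAt (fun s : ℝ ↦ (((Kerr.delta M a s : ℝ) : ℂ) * deriv R s * conj (R s)).im)
      (kgRadialPotential M a w m Λ μ r * R r / ((Kerr.delta M a r : ℝ) : ℂ) * conj (R r) +
        ((Kerr.delta M a r : ℝ) : ℂ) * deriv R r * conj (deriv R r)).im r :=
    Complex.imCLM.hasFDerivAt.comp_hasDerivAt r hK
  refine him.congr_deriv ?_
  have hRR : R r * conj (R r) = ((‖R r‖ ^ 2 : ℝ) : ℂ) := by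
    rw [Complex.mul_conj, Complex.normSq_eq_norm_sq]
  have hR'R' : deriv R r * conj (deriv R r) = ((‖deriv R r‖ ^ 2 : ℝ) : ℂ) := by
    rw [Complex.mul_conj, Complex.normSq_eq_norm_sq]
  have e1 : kgRadialPotential M a w m Λ μ r * R r / ((Kerr.delta M a r : ℝ) : ℂ) * conj (R r) =
      kgRadialPotential M a w m Λ μ r * (((‖R r‖ ^ 2 / Kerr.delta M a r : ℝ)) : ℂ) := by
    rw [Complex.ofReal_div, ← hRR]
    field_simp
  have e2 : ((Kerr.delta M a r : ℝ) : ℂ) * deriv R r * conj (deriv R r) =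
      ((Kerr.delta M a r * ‖deriv R r‖ ^ 2 : ℝ) : ℂ) := by
    rw [Complex.ofReal_mul, ← hR'R']
    ring
  rw [e1, e2]
  simp only [Complex.add_im, Complex.mul_im, Complex.ofReal_re, Complex.ofReal_im, mul_zero, add_zero]
  ring

/-- **`V_μ` is real for real `ω` and `λ`.** [cite: ShlapentokhRothman2014KleinGordon, §3.1] -/
theorem kgRadialPotential_im_eq_zero (M a : ℝ) {w : ℂ} (hw : w.im = 0) (m : ℤ) {Λ : ℂ}
    (hΛ : Λ.im = 0) (μ r : ℝ) : (kgRadialPotential M a w m Λ μ r).im = 0 := by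
  have hw2 : (w ^ 2).im = 0 := by simp [pow_two, Complex.mul_im, hw]
  unfold kgRadialPotential
  simp only [Complex.add_im, Complex.sub_im, Complex.mul_im, Complex.neg_im, Complex.ofReal_re,
    Complex.ofReal_im, hw, hw2, hΛ, mul_zero, zero_mul, add_zero, neg_zero, sub_zero]

/-- A real function on `(r₀, ∞)` with vanishing derivative is constant there. [folklore] -/
theorem eq_of_hasDerivAt_zero_Ioi {g : ℝ → ℝ} {r₀ : ℝ} (hg : ∀ t ∈ Ioi r₀, HasDerivAt g 0 t)
    {r s : ℝ} (hr : r₀ < r) (hs : r₀ < s) : g r = g s := by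
  have hcont : ContinuousOn g (Ioi r₀) := fun t ht ↦ (hg t ht).continuousAt.continuousWithinAt
  have hdiff : DifferentiableOn ℝ g (interior (Ioi r₀)) := fun t ht ↦
    (hg t (interior_subset ht)).differentiableAt.differentiableWithinAt
  have hd0 : ∀ t ∈ interior (Ioi r₀), deriv g t = 0 := fun t ht ↦ (hg t (interior_subset ht)).deriv
  have hmono : MonotoneOn g (Ioi r₀) :=
    monotoneOn_of_deriv_nonneg (convex_Ioi r₀) hcont hdiff fun t ht ↦ (hd0 t ht).symm.le
  have hanti : AntitoneOn g (Ioi r₀) :=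
    antitoneOn_of_deriv_nonpos (convex_Ioi r₀) hcont hdiff fun t ht ↦ (hd0 t ht).le
  rcases le_total r s with h | h
  · exact le_antisymm (hmono hr hs h) (hanti hr hs h)
  · exact le_antisymm (hanti hs hr h) (hmono hs hr h)

/-- **Conservation of the energy current** (`dQ_T/dr = 0`, SR §3.1): for real `ω` and `λ` and a
solution `R` of the radial ODE (2.2), `Q_T = Im(Δ R' R̄)` takes the same value at any two points of
`(r₊, ∞)`. [cite: ShlapentokhRothman2014KleinGordon, §3.1] -/
theorem im_radialFlux_eq (hMa : Kerr.IsSubextremal M a) (hw : w.im = 0) (hΛ : Λ.im = 0)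
    (hR : IsRadialSolution M a w m Λ μ R) {r s : ℝ} (hr : Kerr.rPlus M a < r)
    (hs : Kerr.rPlus M a < s) :
    (((Kerr.delta M a r : ℝ) : ℂ) * deriv R r * conj (R r)).im =
      (((Kerr.delta M a s : ℝ) : ℂ) * deriv R s * conj (R s)).im := by
  refine eq_of_hasDerivAt_zero_Ioi
    (g := fun t : ℝ ↦ (((Kerr.delta M a t : ℝ) : ℂ) * deriv R t * conj (R t)).im)
    (fun t ht ↦ ?_) hr hs
  have h := hasDerivAt_im_radialFlux hMa hR (mem_Ioi.1 ht)
  rwa [kgRadialPotential_im_eq_zero M a hw m hΛ μ t, zero_mul, zero_div] at h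

/-! ### The weighted Wronskian `Δ (R₁' R₂ − R₂' R₁)` -/

/-- **Abel's identity for the radial ODE**: for two solutions `R₁`, `R₂` of (2.2) with the same
parameters, `Δ (R₁' R₂ − R₂' R₁)` has derivative `0` on `(r₊, ∞)`.
[cite: ShlapentokhRothman2014KleinGordon, App. C.3] -/
theorem hasDerivAt_radialWronskian (hMa : Kerr.IsSubextremal M a)
    (h₁ : IsRadialSolution M a w m Λ μ R₁) (h₂ : IsRadialSolution M a w m Λ μ R₂) {r : ℝ}
    (hr : Kerr.rPlus M a < r) :
    HasDerivAt (fun s : ℝ ↦ ((Kerr.delta M a s : ℝ) : ℂ) * deriv R₁ s * R₂ s -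
      ((Kerr.delta M a s : ℝ) : ℂ) * deriv R₂ s * R₁ s) 0 r := by
  have hΔ : ((Kerr.delta M a r : ℝ) : ℂ) ≠ 0 :=
    Complex.ofReal_ne_zero.2 (Kerr.delta_pos hMa.le hr).ne'
  have hf₁ := hasDerivAt_radialFlux hMa h₁ hr
  have hf₂ := hasDerivAt_radialFlux hMa h₂ hr
  have hd₁ := (h₁.hasDerivAt hr).1
  have hd₂ := (h₂.hasDerivAt hr).1
  have h := (hf₁.fun_mul hd₂).sub (hf₂.fun_mul hd₁)
  refine h.congr_deriv ?_
  field_simp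
  ring

/-- **The weighted Wronskian is constant** on `(r₊, ∞)`.
[cite: ShlapentokhRothman2014KleinGordon, App. C.3] -/
theorem radialWronskian_eq (hMa : Kerr.IsSubextremal M a)
    (h₁ : IsRadialSolution M a w m Λ μ R₁) (h₂ : IsRadialSolution M a w m Λ μ R₂) {r s : ℝ}
    (hr : Kerr.rPlus M a < r) (hs : Kerr.rPlus M a < s) :
    ((Kerr.delta M a r : ℝ) : ℂ) * deriv R₁ r * R₂ r - ((Kerr.delta M a r : ℝ) : ℂ) * deriv R₂ r * R₁ r =
      ((Kerr.delta M a s : ℝ) : ℂ) * deriv R₁ s * R₂ s -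
        ((Kerr.delta M a s : ℝ) : ℂ) * deriv R₂ s * R₁ s := by
  set W : ℝ → ℂ := fun t ↦ ((Kerr.delta M a t : ℝ) : ℂ) * deriv R₁ t * R₂ t -
    ((Kerr.delta M a t : ℝ) : ℂ) * deriv R₂ t * R₁ t with hW
  have hWd : ∀ t ∈ Ioi (Kerr.rPlus M a), HasDerivAt W 0 t := fun t ht ↦
    hasDerivAt_radialWronskian hMa h₁ h₂ ht
  -- real and imaginary parts have zero derivative, hence are constant
  have hre : ∀ t ∈ Ioi (Kerr.rPlus M a), HasDerivAt (fun x ↦ (W x).re) 0 t := fun t ht ↦ by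
    have h : HasDerivAt (fun x ↦ (W x).re) (Complex.reCLM 0) t :=
      Complex.reCLM.hasFDerivAt.comp_hasDerivAt t (hWd t ht)
    exact h.congr_deriv (by simp)
  have him : ∀ t ∈ Ioi (Kerr.rPlus M a), HasDerivAt (fun x ↦ (W x).im) 0 t := fun t ht ↦ by
    have h : HasDerivAt (fun x ↦ (W x).im) (Complex.imCLM 0) t :=
      Complex.imCLM.hasFDerivAt.comp_hasDerivAt t (hWd t ht)
    exact h.congr_deriv (by simp)
  apply Complex.ext
  · exact eq_of_hasDerivAt_zero_Ioi hre hr hs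
  · exact eq_of_hasDerivAt_zero_Ioi him hr hs

/-! ### The current of a combination of two real solutions -/

/-- **`Q_T` of a combination of real solutions** (SR §4.3, the display before (4.x)
"`Q_T = |A|²Δ Im(ρ₁' ρ̄₁) + … = 2√(μ²−ω_R²) Im(A B̄)`"): if at a point the values `p₁, p₂` and
derivatives `q₁, q₂` of two solutions are real, then for `φ = Aρ₁ + Bρ₂`,
`Im(Δ φ' φ̄) = Im(A B̄) · Δ (q₁ p₂ − q₂ p₁)` — the current is `Im(A B̄)` times the (real, constant)
weighted Wronskian. [cite: ShlapentokhRothman2014KleinGordon, §4.3] -/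
theorem im_flux_combination (D : ℝ) (A B : ℂ) {p₁ p₂ q₁ q₂ : ℂ} (hp₁ : p₁.im = 0)
    (hp₂ : p₂.im = 0) (hq₁ : q₁.im = 0) (hq₂ : q₂.im = 0) :
    ((D : ℂ) * (A * q₁ + B * q₂) * conj (A * p₁ + B * p₂)).im =
      (A * conj B).im * (D * (q₁.re * p₂.re - q₂.re * p₁.re)) := by
  have e₁ : p₁ = (p₁.re : ℂ) := Complex.ext rfl (by simp [hp₁])
  have e₂ : p₂ = (p₂.re : ℂ) := Complex.ext rfl (by simp [hp₂])
  have e₃ : q₁ = (q₁.re : ℂ) := Complex.ext rfl (by simp [hq₁])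
  have e₄ : q₂ = (q₂.re : ℂ) := Complex.ext rfl (by simp [hq₂])
  rw [e₁, e₂, e₃, e₄]
  simp only [map_add, map_mul, Complex.conj_ofReal, Complex.mul_im, Complex.mul_re, Complex.add_re,
    Complex.add_im, Complex.ofReal_re, Complex.ofReal_im, Complex.conj_re, Complex.conj_im]
  ring

/-- **The energy current of `φ = Aρ₁ + Bρ₂` on `(r₊, ∞)`** for two real-valued solutions `ρ₁`,
`ρ₂`: `Im(Δ φ' φ̄)(r) = Im(A B̄) · Δ(r) (ρ₁'(r) ρ₂(r) − ρ₂'(r) ρ₁(r))`.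
[cite: ShlapentokhRothman2014KleinGordon, §4.3] -/
theorem im_radialFlux_combination {ρ₁ ρ₂ φ : ℝ → ℂ} {A B : ℂ}
    (h₁ : IsRadialSolution M a w m Λ μ ρ₁) (h₂ : IsRadialSolution M a w m Λ μ ρ₂)
    (hreal₁ : ∀ r ∈ Ioi (Kerr.rPlus M a), (ρ₁ r).im = 0)
    (hreal₂ : ∀ r ∈ Ioi (Kerr.rPlus M a), (ρ₂ r).im = 0)
    (hφ : ∀ r ∈ Ioi (Kerr.rPlus M a), φ r = A * ρ₁ r + B * ρ₂ r) {r : ℝ}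
    (hr : Kerr.rPlus M a < r) :
    (((Kerr.delta M a r : ℝ) : ℂ) * deriv φ r * conj (φ r)).im =
      (A * conj B).im * (Kerr.delta M a r *
        ((deriv ρ₁ r).re * (ρ₂ r).re - (deriv ρ₂ r).re * (ρ₁ r).re)) := by
  -- the derivatives of real-valued functions are real
  have hdreal : ∀ {ρ : ℝ → ℂ}, IsRadialSolution M a w m Λ μ ρ →
      (∀ s ∈ Ioi (Kerr.rPlus M a), (ρ s).im = 0) → (deriv ρ r).im = 0 := by
    intro ρ hρ hρreal
    have hd := (hρ.hasDerivAt hr).1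
    have him : HasDerivAt (fun s ↦ (ρ s).im) (Complex.imCLM (deriv ρ r)) r :=
      Complex.imCLM.hasFDerivAt.comp_hasDerivAt r hd
    have him : HasDerivAt (fun s ↦ (ρ s).im) (deriv ρ r).im r := him.congr_deriv (by simp)
    have hzero : HasDerivAt (fun s ↦ (ρ s).im) 0 r := by
      have hloc : (fun s ↦ (ρ s).im) =ᶠ[𝓝 r] fun _ ↦ (0 : ℝ) := by
        filter_upwards [Ioi_mem_nhds hr] with s hs using hρreal s hs
      exact (hasDerivAt_const r (0 : ℝ)).congr_of_eventuallyEq hloc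
    exact him.unique hzero
  have hq₁ := hdreal h₁ hreal₁
  have hq₂ := hdreal h₂ hreal₂
  -- the derivative of `φ`
  have hφd : deriv φ r = A * deriv ρ₁ r + B * deriv ρ₂ r := by
    have hloc : φ =ᶠ[𝓝 r] fun s ↦ A * ρ₁ s + B * ρ₂ s := by
      filter_upwards [Ioi_mem_nhds hr] with s hs using hφ s hs
    rw [hloc.deriv_eq]
    exact (((h₁.hasDerivAt hr).1.const_mul A).add ((h₂.hasDerivAt hr).1.const_mul B)).deriv
  rw [hφd, hφ r hr]
  exact im_flux_combination (Kerr.delta M a r) A B (hreal₁ r hr) (hreal₂ r hr) hq₁ hq₂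

end Literature.Barriers.FinalStateConjecture

end
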